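import Summits.QuantumFields.YangMills.Theorems.UnitScaleTiltFluctuationComparisonRegPrGlobalSlackCanonicalPolymers
import Summits.QuantumFields.YangMills.Theorems.UnitScaleTiltFluctuationComparisonRegPrPolymerBudget
import HarnessLib

/-!
# `UnitScaleTiltFluctuationComparisonRegPrGlobalSlackCanonicalPolymersVolume` — THE BLOCK-VOLUME ROW FOR THE CANONICAL POLYMERISATION OF A v3 FAMILY
# (crux `FluctuationComparisonRegPrL`, stmt-QuantumFields-19935, STUB 3⁗ `stub_globalTwoRunSlackFam`; width-lever lane A, the producer's third row)

Seat ym-ust-19935-slack g0 (prover).  `T3AlphaInputsACTwoRunLevel.LocBlockVolume D` — «every listed level-`i` localisation domain of run `K` contains at least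
`L^{3i}` fine sites» ([Balaban1985UV3] (24) p.262: localisations are unions of big blocks) — for the datum `dataOfV3 p (canonPolymer p)` of the canonical
polymerisation (`…GlobalSlackCanonicalPolymers`): the OLD-term domains are blocks `blockSet K i y` with EXACTLY `L^{3i}` fine sites (the `i`-fold block map is
LQB's `Site.proj i i`, whose fibres have `(Lⁱ)³` points, `Site.card_fibre`); the dummy domain above the top is the whole torus (`8L^{3(m+K)} ≥ L³`, `m ≥ 1`); the
NEW-term domains `domSet M₁ K k X` contain a whole scale-`k` big block, i.e. at least `min(M₁, 2L^{m+K−k})³ · L^{3k}` fine sites, which is `≥ L^{3(k+1)}` as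
soon as the big-block size dominates the block size, `L ≤ M₁` (print: «M₁ sufficiently large», p.262; the constants record carries only `0 < M₁`, so the
inequality is an explicit hypothesis here).

* §1 `coarsen_eq_proj` (`Carriers.coarsen i = Site.proj i i` on the fine torus, `i ≤ m + K`), `card_filter_coarsen` (`#{x | coarsen i x = y} = (Lⁱ)³`),
  `sum_indicator_blockSet` (the volume of a block domain is `L^{3i}`);
* §2 big blocks: `offSite` (the level-`k` sites `t·M₁ + r` of a big block, `val_offSite`/`offSite_injective`/`bigLabel_offSite`), `card_filter_coarsen_mem`
  (`#{x | coarsen k x ∈ Z} = #Z·(L^k)³`), `pow_le_sum_indicator_domSet` (`L^{3(k+1)} ≤ #domSet` for `k + 1 ≤ m + K`, `L ≤ M₁`);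
* §3 **`locBlockVolume_canon (hM : F.L ≤ 𝔠.M₁) : LocBlockVolume (dataOfV3 p (canonPolymer p))`**.
Pure lattice combinatorics; nothing of [Balaban1985UV3] is asserted.

References: T. Bałaban, CMP 102 (1985) 255–275 [Balaban1985UV3] ((24) p.262, (39) p.266, (59) p.270); CMP 109 (1987) 249–301 [Balaban1987RG1] ((0.1)–(0.3) pp.251–252).
-/

set_option autoImplicit false

noncomputable section

namespace Summit.QuantumFields.YangMills.Theorems.GlobalSlackCanonicalPolymers

open scoped BigOperators
open Finset
open Literature.MathematicalPhysics.QuantumFieldTheory.Balaban1983to89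
open Literature.MathematicalPhysics.QuantumFieldTheory.Balaban1983to89.T3ContinuumYM3Torus
open Literature.MathematicalPhysics.QuantumFieldTheory.Balaban1983to89.T3AlphaInputsAC
open Literature.MathematicalPhysics.QuantumFieldTheory.Balaban1983to89.T3AlphaInputsACTwoRunLevel
open Literature.MathematicalPhysics.QuantumFieldTheory.Balaban1983to89.TreeLengthTorus (tsys)
open Literature.MathematicalPhysics.QuantumFieldTheory.Balaban1985CMP102
open Literature.MathematicalPhysics.QuantumFieldTheory.Balaban1985CMP102.Setting
open Summit.QuantumFields.Balaban3D.Carriers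
open Summit.QuantumFields.Balaban3D.Proofs.Primitives
open Summit.QuantumFields.YangMills.Theorems

variable {F : T3Family}

/-! ## §1 Blocks: the `i`-fold block map is `Site.proj i i`, its fibres have `(Lⁱ)³` points -/

/-- `sitesPerDir 0 = Lⁱ · sitesPerDir i` on run `K`'s torus for `i ≤ m + K`. [cite: Balaban1987RG1, (0.1) p.251] -/
theorem sitesPerDir_zero_eq_pow (K i : ℕ) (hi : i ≤ F.m + K) : (F.P K).sitesPerDir 0 = (F.P K).L ^ i * (F.P K).sitesPerDir i := by
  have h := B1RG242Torus.sitesPerDir_zero_eq (F.P K) i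
  rwa [B1RG242Torus.lvl_of_le (P := F.P K) (show i ≤ (F.P K).m + (F.P K).K from hi)] at h

/-- `sitesPerDir i = L · sitesPerDir (i+1)` for `i + 1 ≤ m + K`. [cite: Balaban1987RG1, (0.1) p.251] -/
theorem sitesPerDir_eq_mul_succ (K i : ℕ) (hi : i + 1 ≤ F.m + K) : (F.P K).sitesPerDir i = (F.P K).L ^ 1 * (F.P K).sitesPerDir (i + 1) := by
  have h := B1RG242Torus.sitesPerDir_eq_succ (F.P K) i
  rwa [B1RG242Torus.stepExp_of_lt (P := F.P K) (show i + 1 ≤ (F.P K).m + (F.P K).K from hi)] at h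

/-- **THE `i`-FOLD BLOCK MAP IS `Site.proj i i`** on run `K`'s fine torus (`i ≤ m + K`). [cite: Balaban1987RG1, (0.3) p.252] -/
theorem coarsen_eq_proj (K : ℕ) : ∀ (i : ℕ), i ≤ F.m + K → ∀ x : Site (F.P K) 0, coarsen i x = Site.proj i i x
  | 0, _, x => (Site.proj_zero x).symm
  | i + 1, hi, x => by
    rw [coarsen_succ, coarsen_eq_proj K i (by omega) x, ← Site.proj_one_eq_blockOf,
      Site.proj_comp (sitesPerDir_zero_eq_pow K i (by omega)) (sitesPerDir_eq_mul_succ K i hi)]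

/-- **A BLOCK HAS `(Lⁱ)³` FINE SITES**: `#{x | coarsen i x = y} = (Lⁱ)³` (`Site.card_fibre`). [cite: Balaban1987RG1, (0.3) p.252] -/
theorem card_filter_coarsen (K i : ℕ) (hi : i ≤ F.m + K) (y : Site (F.P K) i) :
    (univ.filter fun x : Site (F.P K) 0 => coarsen i x = y).card = ((F.P K).L ^ i) ^ 3 := by
  classical
  have h := Site.card_fibre (i := 0) (sitesPerDir_zero_eq_pow K i hi) y
  rw [T3Family.P_d] at h
  rw [← h]
  exact Finset.card_bij (fun x _ => x) (fun x hx => by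
      rw [mem_filter] at hx ⊢; exact ⟨hx.1, by rw [← coarsen_eq_proj K i hi x]; exact hx.2⟩)
    (fun _ _ _ _ h => h) (fun x hx => ⟨x, by
      rw [mem_filter] at hx ⊢; exact ⟨hx.1, by rw [coarsen_eq_proj K i hi x]; exact hx.2⟩, rfl⟩)

/-- The volume of a set of fine sites as a filter cardinality. [folklore] -/
theorem sum_indicator_eq_card (K : ℕ) (Y : Set (Site (F.P K) 0)) [DecidablePred (· ∈ Y)] :
    ∑ x : Site (F.P K) 0, Y.indicator (fun _ => (1 : ℝ)) x = ((univ.filter fun x => x ∈ Y).card : ℝ) := by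
  classical
  rw [Finset.card_filter, Nat.cast_sum]
  refine Finset.sum_congr rfl fun x _ => ?_
  by_cases hx : x ∈ Y
  · rw [Set.indicator_of_mem hx, if_pos hx, Nat.cast_one]
  · rw [Set.indicator_of_notMem hx, if_neg hx, Nat.cast_zero]

/-- **THE VOLUME OF A BLOCK DOMAIN IS `L^{3i}`** (`i ≤ m + K`). [cite: Balaban1985UV3, (24) p.262] -/
theorem sum_indicator_blockSet (K i : ℕ) (hi : i ≤ F.m + K) (y : Site (F.P K) i) :
    ∑ x : Site (F.P K) 0, (blockSet K i y).indicator (fun _ => (1 : ℝ)) x = (F.L : ℝ) ^ (3 * i) := by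
  classical
  rw [sum_indicator_eq_card]
  have h := card_filter_coarsen K i hi y
  have hset : (univ.filter fun x : Site (F.P K) 0 => x ∈ blockSet K i y) = univ.filter fun x => coarsen i x = y := by
    ext x; simp [blockSet]
  rw [hset, h]
  push_cast
  rw [← pow_mul, mul_comm]
  rfl

/-! ## §2 Big blocks: a `domSet` contains a whole scale-`k` big block -/

/-- The level-`k` sites with big-block label `t` built from offsets `r < w`: `z_μ = t_μ·M₁ + r_μ` (no wrap-around when `(t_μ + 1)·M₁ ≤ S_k`, resp. `w ≤ S_k`
for `t = 0`). [cite: Balaban1985UV3, (7) p.257] -/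
def offSite (F : T3Family) (K k : ℕ) (M₁ : ℕ) (t : Fin 3 → ℕ) {w : ℕ} (r : Fin 3 → Fin w) : Site (F.P K) k :=
  fun μ => (((t μ) * M₁ + r μ : ℕ) : ZMod ((F.P K).sitesPerDir k))

/-- Label of `offSite`: `(z μ).val = t_μ·M₁ + r_μ` when `t_μ·M₁ + w ≤ S_k`. [folklore] -/
theorem val_offSite (K k M₁ : ℕ) (t : Fin 3 → ℕ) {w : ℕ} (r : Fin 3 → Fin w) (μ : Fin 3)
    (h : t μ * M₁ + w ≤ (F.P K).sitesPerDir k) : ((offSite F K k M₁ t r) μ).val = t μ * M₁ + r μ := by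
  simp only [offSite]
  rw [ZMod.val_natCast, Nat.mod_eq_of_lt]
  have := (r μ).isLt
  omega

/-- `offSite` is injective in the offsets (no wrap-around). [folklore] -/
theorem offSite_injective (K k M₁ : ℕ) (t : Fin 3 → ℕ) {w : ℕ} (h : ∀ μ, t μ * M₁ + w ≤ (F.P K).sitesPerDir k) :
    Function.Injective (offSite F K k M₁ t (w := w)) := by
  intro r r' hrr
  funext μ
  have h1 := val_offSite K k M₁ t r μ (h μ)
  have h2 := val_offSite K k M₁ t r' μ (h μ)
  have h3 : ((offSite F K k M₁ t r) μ).val = ((offSite F K k M₁ t r') μ).val := by rw [hrr]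
  rw [h1, h2] at h3
  exact Fin.ext (by omega)

/-- The big-block label of `offSite t r` is `t` when `r < M₁` and no wrap-around. [cite: Balaban1985UV3, (7) p.257] -/
theorem bigLabel_offSite (K k M₁ : ℕ) (hM : 0 < M₁) (t : Fin 3 → ℕ) (r : Fin 3 → Fin M₁) (μ : Fin 3)
    (h : t μ * M₁ + M₁ ≤ (F.P K).sitesPerDir k) : ((offSite F K k M₁ t r) μ).val / M₁ = t μ := by
  rw [val_offSite K k M₁ t r μ h, Nat.add_comm, Nat.add_mul_div_right _ _ hM, Nat.div_eq_of_lt (r μ).isLt, zero_add]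

/-- With `t = 0` and offsets `< S_k ≤ M₁` (small torus) the big-block label is `0`. [cite: Balaban1985UV3, (7) p.257] -/
theorem bigLabel_offSite_zero (K k M₁ : ℕ) (hS : (F.P K).sitesPerDir k ≤ M₁) (r : Fin 3 → Fin ((F.P K).sitesPerDir k)) (μ : Fin 3) :
    ((offSite F K k M₁ (fun _ => 0) r) μ).val / M₁ = 0 := by
  rw [val_offSite K k M₁ (fun _ => 0) r μ (by simp), zero_mul, zero_add]
  exact Nat.div_eq_of_lt (lt_of_lt_of_le (r μ).isLt hS)

/-- **THE FINE SITES OVER A SET OF LEVEL-`k` SITES**: `#{x | coarsen k x ∈ Z} = #Z · (L^k)³` (`k ≤ m + K`). [cite: Balaban1987RG1, (0.3) p.252] -/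
theorem card_filter_coarsen_mem (K k : ℕ) (hk : k ≤ F.m + K) (Z : Finset (Site (F.P K) k)) :
    (univ.filter fun x : Site (F.P K) 0 => coarsen k x ∈ Z).card = Z.card * ((F.P K).L ^ k) ^ 3 := by
  classical
  have H : ∀ x ∈ (univ.filter fun x : Site (F.P K) 0 => coarsen k x ∈ Z), coarsen k x ∈ Z :=
    fun x hx => (mem_filter.mp hx).2
  have hfib : ∀ z ∈ Z, ((univ.filter fun x : Site (F.P K) 0 => coarsen k x ∈ Z).filter fun x => coarsen k x = z).card =
      ((F.P K).L ^ k) ^ 3 := by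
    intro z hz
    rw [Finset.filter_filter]
    have : (univ.filter fun x : Site (F.P K) 0 => coarsen k x ∈ Z ∧ coarsen k x = z) = univ.filter fun x => coarsen k x = z := by
      ext x; simp only [mem_filter, mem_univ, true_and]; exact ⟨fun h => h.2, fun h => ⟨h ▸ hz, h⟩⟩
    rw [this, card_filter_coarsen K k hk z]
  rw [Finset.card_eq_sum_card_fiberwise H, Finset.sum_const_nat hfib]

variable {𝔠 : AlphaConsts F.L (suGroupModel 2).N} {γ : ℝ} {hγ : 0 < γ} {hγ1 : γ ≤ (min 𝔠.gamma0 1) ^ 2}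

/-- The number of big blocks per direction at step `k` of run `K` unfolds to `max 1 (S_k / M₁)` (definitional). [cite: Balaban1985UV3, (39) p.266] -/
theorem nblkOf_SK (K k : ℕ) :
    nblkOf (SK F 𝔠 γ hγ hγ1 K) 𝔠.lane.carrier k = max 1 ((F.P K).sitesPerDir k / 𝔠.M₁) := rfl

/-- **A `domSet` CONTAINS A WHOLE BIG BLOCK, HENCE `≥ L^{3(k+1)}` FINE SITES** for a domain at step `k` of run `K` with `k + 1 ≤ m + K`, once `L ≤ M₁`:
the big block of any label `b ∈ X.1` consists of `M₁³` level-`k` sites if `M₁ ≤ S_k` (labels `< N = S_k/M₁`, no wrap-around), of ALL `S_k³` sites if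
`S_k < M₁` (`N = 1`); each level-`k` site carries `(L^k)³` fine sites. [cite: Balaban1985UV3, (24) p.262, (39) p.266, (59) p.270] -/
theorem pow_le_sum_indicator_domSet (hM : F.L ≤ 𝔠.M₁) (K k : ℕ) (hk : k + 1 ≤ F.m + K)
    (X : (tsys 3 (nblkOf (SK F 𝔠 γ hγ hγ1 K) 𝔠.lane.carrier k)).Dom) :
    (F.L : ℝ) ^ (3 * (k + 1)) ≤ ∑ x : Site (F.P K) 0, (domSet (F := F) 𝔠.lane.carrier.M₁ K k X).indicator (fun _ => (1 : ℝ)) x := by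
  classical
  obtain ⟨b, hb⟩ := X.2.1
  have hM0 : 0 < 𝔠.M₁ := 𝔠.M₁_pos
  rw [sum_indicator_eq_card]
  by_cases hcase : 𝔠.M₁ ≤ (F.P K).sitesPerDir k
  · -- no wrap-around: the big block `b` has `M₁³` level-`k` sites
    have hN : nblkOf (SK F 𝔠 γ hγ hγ1 K) 𝔠.lane.carrier k = (F.P K).sitesPerDir k / 𝔠.M₁ := by
      rw [nblkOf_SK]; exact max_eq_right (Nat.div_pos hcase hM0)
    have ht : ∀ μ, (b μ).val * 𝔠.M₁ + 𝔠.M₁ ≤ (F.P K).sitesPerDir k := fun μ => by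
      have h1 : (b μ).val < (F.P K).sitesPerDir k / 𝔠.M₁ := lt_of_lt_of_eq (ZMod.val_lt (b μ)) hN
      calc (b μ).val * 𝔠.M₁ + 𝔠.M₁ = ((b μ).val + 1) * 𝔠.M₁ := by ring
        _ ≤ ((F.P K).sitesPerDir k / 𝔠.M₁) * 𝔠.M₁ := Nat.mul_le_mul_right _ h1
        _ ≤ (F.P K).sitesPerDir k := Nat.div_mul_le_self _ _
    set Z : Finset (Site (F.P K) k) := univ.image (offSite F K k 𝔠.M₁ (fun μ => (b μ).val) (w := 𝔠.M₁)) with hZ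
    have hZcard : Z.card = 𝔠.M₁ ^ 3 := by
      rw [hZ, card_image_of_injective _ (offSite_injective K k 𝔠.M₁ _ ht), card_univ, Fintype.card_fun, Fintype.card_fin, Fintype.card_fin]
    have hsub : (univ.filter fun x : Site (F.P K) 0 => coarsen k x ∈ Z) ⊆
        univ.filter fun x => x ∈ domSet (F := F) 𝔠.lane.carrier.M₁ K k X := by
      intro x hx
      rw [mem_filter] at hx ⊢
      obtain ⟨r, -, hr⟩ := mem_image.mp hx.2
      refine ⟨hx.1, ?_⟩
      simp only [domSet, Set.mem_setOf_eq]
      refine ⟨b, hb, funext fun μ => ?_⟩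
      show ((coarsen k x) μ).val / 𝔠.M₁ = (b μ).val
      rw [← hr]
      exact bigLabel_offSite K k 𝔠.M₁ hM0 _ r μ (ht μ)
    have hpow : F.L ^ (3 * (k + 1)) ≤ 𝔠.M₁ ^ 3 * ((F.P K).L ^ k) ^ 3 := by
      have e : F.L ^ (3 * (k + 1)) = F.L ^ 3 * (F.L ^ k) ^ 3 := by
        rw [show 3 * (k + 1) = 3 + k * 3 by ring, pow_add, pow_mul]
      rw [e]
      exact Nat.mul_le_mul_right _ (Nat.pow_le_pow_left hM 3)
    calc (F.L : ℝ) ^ (3 * (k + 1)) ≤ ((𝔠.M₁ ^ 3 * ((F.P K).L ^ k) ^ 3 : ℕ) : ℝ) := by exact_mod_cast hpow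
      _ = ((univ.filter fun x : Site (F.P K) 0 => coarsen k x ∈ Z).card : ℝ) := by
          rw [card_filter_coarsen_mem K k (by omega) Z, hZcard]
      _ ≤ ((univ.filter fun x : Site (F.P K) 0 => x ∈ domSet (F := F) 𝔠.lane.carrier.M₁ K k X).card : ℝ) := by
          exact_mod_cast card_le_card hsub
  · -- small torus: one big block, every fine site lies in it
    rw [not_le] at hcase
    have hN : nblkOf (SK F 𝔠 γ hγ hγ1 K) 𝔠.lane.carrier k = 1 := by
      rw [nblkOf_SK, Nat.div_eq_of_lt hcase]; rfl
    have hall : (univ.filter fun x : Site (F.P K) 0 => x ∈ domSet (F := F) 𝔠.lane.carrier.M₁ K k X) = univ := by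
      refine Finset.filter_true_of_mem fun x _ => ?_
      simp only [domSet, Set.mem_setOf_eq]
      refine ⟨b, hb, funext fun μ => ?_⟩
      have h1 : ((coarsen k x) μ).val < 𝔠.M₁ := lt_trans (ZMod.val_lt _) hcase
      have h2 : (b μ).val = 0 := by have := lt_of_lt_of_eq (ZMod.val_lt (b μ)) hN; omega
      show ((coarsen k x) μ).val / 𝔠.M₁ = (b μ).val
      rw [h2]
      exact Nat.div_eq_of_lt h1
    rw [hall, card_univ, LogComparisonPolymerBudget.card_site_zero]
    have hL1 : (1 : ℝ) ≤ F.L := by exact_mod_cast F.hL.2.le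
    have hx0 : (0 : ℝ) ≤ (F.L : ℝ) ^ (3 * (F.m + K)) := by positivity
    calc (F.L : ℝ) ^ (3 * (k + 1)) ≤ (F.L : ℝ) ^ (3 * (F.m + K)) := pow_le_pow_right₀ hL1 (by omega)
      _ ≤ 8 * (F.L : ℝ) ^ (3 * (F.m + K)) := by linarith

/-! ## §3 The volume row for the canonical polymerisation -/

/-- **`LocBlockVolume` FOR THE CANONICAL POLYMERISATION OF EVERY v3 FAMILY, GIVEN `L ≤ M₁`**: every listed level-`i` domain of `canonPolymer p` contains at least
`L^{3i}` fine sites — blocks exactly `L^{3i}`, the dummy whole-torus domain `8L^{3(m+K)} ≥ L³`, new-term domains a whole big block (§2).  The producer's THIRD row,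
discharged (for `L ≤ M₁`; print p.262 «M₁ sufficiently large»). [cite: Balaban1985UV3, (24) p.262, (45)-(46) p.267] -/
theorem locBlockVolume_canon (p : ∀ K, AlphaInputsT3AC.PkgAtV3 F 𝔠 γ hγ hγ1 K) (hM : F.L ≤ 𝔠.M₁) :
    LocBlockVolume (AlphaInputsT3AC.dataOfV3 p (canonPolymer p)) := by
  classical
  intro K j h i Y hY
  change Y ∈ canonLoc p K j h i at hY
  cases j with
  | zero => simp [canonLoc] at hY
  | succ k =>
    by_cases hk : k + 1 ≤ K
    · by_cases hik : i = k + 1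
      · subst hik
        simp only [canonLoc, if_pos hk, ite_true, mem_image] at hY
        obtain ⟨X, -, rfl⟩ := hY
        exact pow_le_sum_indicator_domSet hM K k (by have := F.hm; omega) X
      · by_cases hi : i ∈ Finset.Icc 1 k
        · simp only [canonLoc, if_pos hk, if_neg hik, if_pos hi, mem_image] at hY
          obtain ⟨y, -, rfl⟩ := hY
          have hik' : i ≤ F.m + K := by have := (Finset.mem_Icc.mp hi).2; have := F.hm; omega
          rw [sum_indicator_blockSet K i hik' y]
        · simp only [canonLoc, if_pos hk, if_neg hik, if_neg hi] at hY
          simp at hY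
    · by_cases hi1 : i = 1
      · subst hi1
        simp only [canonLoc, if_neg hk, ite_true, mem_singleton] at hY
        subst hY
        rw [sum_indicator_eq_card, Finset.filter_true_of_mem (fun x _ => Set.mem_univ x), card_univ,
          LogComparisonPolymerBudget.card_site_zero]
        have hL1 : (1 : ℝ) ≤ F.L := by exact_mod_cast F.hL.2.le
        have hx0 : (0 : ℝ) ≤ (F.L : ℝ) ^ (3 * (F.m + K)) := by positivity
        calc (F.L : ℝ) ^ (3 * 1) ≤ (F.L : ℝ) ^ (3 * (F.m + K)) := pow_le_pow_right₀ hL1 (by have := F.hm; omega)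
          _ ≤ 8 * (F.L : ℝ) ^ (3 * (F.m + K)) := by linarith
      · simp only [canonLoc, if_neg hk, if_neg hi1] at hY
        simp at hY

end Summit.QuantumFields.YangMills.Theorems.GlobalSlackCanonicalPolymers

end
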